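import Literature.IUT.HodgeTheaters.PiAvatarBaseKitThetaNFInstances
import Literature.IUT.HodgeTheaters.PiAvatarNFKitTheta
import HarnessLib

/-!
# D-JΘ1-2 (D′): the NF kit over the NAMED NF-widened Θ-kits — `nfKitTheta` (over `V̲`), `nfKitThetaOfBadPairs` (genuine shape),
# `nfKitThetaStandIn` (`X̲→`-stand-in) — abc-iut-L5-t3's p451329 §OverPlaces/§Genuine one-liners re-run over abc-iut-L5-t4's (C′) kits
# (defs by specialisation of `nfKitThetaOfData`; post-freeze additive, not a cone member)

S. Mochizuki, *Inter-universal Teichmüller theory I*, kurims manuscript (May 2020), Def 4.1 (v)(vi) pp. 97–98, Ex 4.3 (i)–(iii) pp. 98–100,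
Ex 4.5 (i)(ii) pp. 107–108, Def 6.1 (v) p. 158. ([IUTchI] Def 4.1 (v) p.97) [claim: Mochizuki2012, status: disputed] (D-0012 claim key, series
status DISPUTED — constructions over abc-iut-L5-t2's REAL `InitialThetaData`; nothing of the series is asserted; no side is taken on
[IUTchIII] Cor. 3.12).

## What this file builds (L5-lead RULINGS #86–#88, D-JΘ1-2; abc-iut-L5-t4 19:54:45Z coordination «(D′) = t3, then (C″) `PiAvatarKitCoreTheta` = t4»)

abc-iut-L5-t4's `PiAvatarBaseKitThetaNFInstances` ((C′)) names the NF-widened Θ-kits `baseKitThetaNF B CG hS hsurj hA Λ` (over the index copy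
of `V̲`), `baseKitThetaNFOfBadPairs CG hS M hA hI B ΛBad` (genuine shape) and `baseKitThetaNFStandIn CG hS M hA hI` (stand-in), each DEFINITIONALLY a
`baseKitThetaNFOfData … D.indexCopyBad D.indexCopyArc δ` for the corresponding local-data family `δ` (`baseKitThetaNFOfBadPairs_eq`,
`baseKitThetaNFStandIn_eq`, both `rfl`).  Hence the NF kit `nfKitThetaOfData` (abc-iut-L5-t3 (D), `PiAvatarNFKitTheta`) specialises to each of them by
the SAME one-liners as abc-iut-L5-t3's `nfKit` / `nfKitOfBadPairs` / `nfKitStandIn` (p451329) — binder `hNF : Surjective toFlStarNF` over `V̲`, DISCHARGED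
from the torsion-monodromy datum `M` at the genuine-shape and stand-in kits (`toFlStarNF_surjective_of_torsionMonodromy`, p437719); `valOfV := indexCopyValEmb`.
These are the `N` inputs displayed by abc-iut-L5-t4's `nonempty_kitCore_baseKitThetaNFOfBadPairs` / `…StandIn` and by the forthcoming (C″)
`PiAvatarKitCoreTheta` (`N := nfKitThetaStandIn`).  No instance, no notation, no Prop fact, no binder added; typed ≠ inhabited ≠ proved; a stand-in
witnesses OUR binders only and is NOT print's tempered `ℬ^temp(X̳_v̲)⁰`.
-/

noncomputable section

namespace Literature.IUT.HodgeTheaters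

open CategoryTheory

universe u v w

section NFKitThetaInstances

variable {F : Type u} {K : Type v} {Fbar : Type w} [Field F] [NumberField F] [Field K] [NumberField K]
  [Algebra F K] [Field Fbar] [Algebra F Fbar] [Algebra K Fbar]
  {E : WeierstrassCurve F} [E.IsElliptic] {l : ℕ} {Pb : BadPlacePredicates K}
  (D : InitialThetaData F K Fbar E l Pb) (CG : D.geom.pe.CuspGalois) (hS : D.CuspClassesNormaliserStable) [Fact l.Prime]

namespace InitialThetaData

/-! ### Over `V̲` -/

section OverPlaces

variable [(D.PiXund.subgroupOf D.PiXK).Normal] (hsurj : Function.Surjective D.toFlStarGlobal) (hA : D.geom.pe.ArrowCoveringClaims)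
  (B : ∀ v, v ∈ D.indexCopyBad → D.BadPairAt v) (Λ : ∀ v, D.LocalArrowLaw CG hS (D.localGroupAt B v))

open Classical in
/-- **THE NF KIT OF THE INITIAL Θ-DATA OVER `V̲`, Θ-AMBIENT VERSION** (over abc-iut-L5-t4's `baseKitThetaNF`), binder
`hNF : Surjective toFlStarNF`. ([IUTchI] Def 4.1 (v) p.97) [claim: Mochizuki2012, status: disputed] -/
def nfKitTheta (hNF : Function.Surjective (D.toFlStarNF CG hS)) : (D.baseKitThetaNF B CG hS hsurj hA Λ).NFKit :=
  D.nfKitThetaOfData CG hS hsurj D.indexCopyBad D.indexCopyArc (D.localDatumAt B CG hS hA Λ) hNF D.indexCopyValEmb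

/-- `[ε] = 1` in the NF kit over `V̲` (definitional). ([IUTchI] Ex 4.5 (ii) p.108) [claim: Mochizuki2012, status: disputed] -/
theorem nfKitTheta_εLab (hNF : Function.Surjective (D.toFlStarNF CG hS)) :
    (D.nfKitTheta CG hS hsurj hA B Λ hNF).εLab = (1 : FlStar l) := rfl

end OverPlaces

/-! ### At the genuine-shape and stand-in Θ-NF kits (`hNF` discharged from the torsion monodromy) -/

section Genuine

variable (M : D.TorsionMonodromy) (hA : D.geom.pe.ArrowCoveringClaims)
  (hI : ∀ k ∈ D.geom.pe.inertia D.geom.pe.ε1, M.tau (D.geom.embK k) = 0)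
  (B : ∀ v, v ∈ D.indexCopyBad → D.BadPairAt v) (ΛBad : ∀ v (h : v ∈ D.indexCopyBad), D.LocalArrowLaw CG hS (B v h).H)

/-- **THE NF KIT AT THE GENUINE-SHAPE Θ-NF KIT `baseKitThetaNFOfBadPairs`** — `hNF` DISCHARGED from the torsion-monodromy datum
(`toFlStarNF_surjective_of_torsionMonodromy`): NO binder beyond the base kit's {`CG`, `hS`, `M`, `hA`, `hI`, `B`, `ΛBad`}.
([IUTchI] Def 4.1 (v) p.97) [claim: Mochizuki2012, status: disputed] -/
def nfKitThetaOfBadPairs : (D.baseKitThetaNFOfBadPairs CG hS M hA hI B ΛBad).NFKit :=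
  haveI := M.normal_PiXund_subgroupOf_PiXK
  D.nfKitTheta CG hS (D.toFlStarGlobal_surjective_of_torsionMonodromy M) hA B
    (D.localArrowLawFamilyOfTorsionMonodromy CG hS M hA hI B
      (fun v _ => D.localArrowLaw_L2_sign_local CG hS hA (D.decompAt v)) ΛBad)
    (D.toFlStarNF_surjective_of_torsionMonodromy CG hS M)

/-- `[ε] = 1` in the genuine-shape Θ-NF kit's NF kit (definitional). ([IUTchI] Ex 4.5 (ii) p.108) [claim: Mochizuki2012, status: disputed] -/
theorem nfKitThetaOfBadPairs_εLab : (D.nfKitThetaOfBadPairs CG hS M hA hI B ΛBad).εLab = (1 : FlStar l) := rfl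

/-- Non-vacuity of the interface `NFKit` at the genuine-shape Θ-NF kit of the REAL initial Θ-data (binders {`CG`,`hS`,`M`,`hA`,`hI`,`B`,`ΛBad`}).
([IUTchI] Def 4.1 (v) p.97) [claim: Mochizuki2012, status: disputed] -/
theorem nonempty_nfKit_baseKitThetaNFOfBadPairs : Nonempty (D.baseKitThetaNFOfBadPairs CG hS M hA hI B ΛBad).NFKit :=
  ⟨D.nfKitThetaOfBadPairs CG hS M hA hI B ΛBad⟩

/-- **THE NF KIT AT THE `X̲→`-STAND-IN Θ-NF KIT `baseKitThetaNFStandIn`** («[`X̲→`-profinite stand-in at `v̲ ∈ V̲^bad`]»: NOT print's tempered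
`ℬ^temp(X̳_v̲)⁰`; binders {`CG`, `hS`, `M`, `hA`, `hI`}) — the `N` of abc-iut-L5-t4's (C″) `PiAvatarKitCoreTheta`.
([IUTchI] Def 4.1 (v) p.97) [claim: Mochizuki2012, status: disputed] -/
def nfKitThetaStandIn : (D.baseKitThetaNFStandIn CG hS M hA hI).NFKit :=
  D.nfKitThetaOfBadPairs CG hS M hA hI (fun v _ => D.badPairAtArrow hA v)
    (fun v _ => D.localArrowLaw_local_of_torsionMonodromy CG hS M hA hI (D.decompAt v))

/-- `[ε] = 1` in the stand-in Θ-NF kit's NF kit (KIT RULE: the NF-side laws FIRE at closed data). ([IUTchI] Ex 4.5 (ii) p.108)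
[claim: Mochizuki2012, status: disputed] -/
theorem nfKitThetaStandIn_εLab : (D.nfKitThetaStandIn CG hS M hA hI).εLab = (1 : FlStar l) := rfl

/-- The isomorphs of `𝒟^⊚` of the stand-in Θ-NF kit's NF kit are abc-iut-L5-t3's `GlobNF` (definitional). ([IUTchI] Def 4.1 (v) p.97)
[claim: Mochizuki2012, status: disputed] -/
theorem nfKitThetaStandIn_GlobNF : (D.nfKitThetaStandIn CG hS M hA hI).GlobNF = D.GlobNF := rfl

/-- Non-vacuity of the interface `NFKit` at the stand-in Θ-NF kit of the REAL initial Θ-data (binders {`CG`,`hS`,`M`,`hA`,`hI`}).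
([IUTchI] Def 4.1 (v) p.97) [claim: Mochizuki2012, status: disputed] -/
theorem nonempty_nfKit_baseKitThetaNFStandIn : Nonempty (D.baseKitThetaNFStandIn CG hS M hA hI).NFKit :=
  ⟨D.nfKitThetaStandIn CG hS M hA hI⟩

end Genuine

end InitialThetaData

end NFKitThetaInstances

end Literature.IUT.HodgeTheaters
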